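import Literature.AlgebraicGeometry.Resolution.RationalMapsOfModels
import Literature.AlgebraicGeometry.Resolution.QuadraticTransformsTree
import Literature.AlgebraicGeometry.Motives.ProjectiveSpaceRingPoints
import Literature.AlgebraicGeometry.Resolution.AlterationsStrictTransformModel
import HarnessLib

/-!
# Centres of local rings of `K` on a projective model and homogeneous coordinates

Topic: `Literature/AlgebraicGeometry/Resolution`. Let `B` be a projective model of `K/k`
(`ProjModel`), `ι_B : B ↪ ℙⁿ_k` a closed `k`-immersion and `w ∈ Kⁿ⁺¹ ∖ 0` homogeneous
coordinates of the generic point `gen_B`. For EVERY local subring `𝔬 ⊆ K` containing `k`, `𝔬`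
has a centre on `B` (`ProjModel.HasCentre`: it dominates some `𝒪_{B,b}`,
`ProjectiveModelsCentresLocal.lean`) iff the vector `w` is DEFINED ON `𝔬` (`DefinedOn w 𝔬`:
`wᵢ ≠ 0` and all `w_l/wᵢ ∈ 𝔬` for some `i`, `QuadraticTransformsTree.lean`) —
`ProjModel.hasCentre_iff_definedOn`. The direction (←) is the morphism `Spec 𝔬 → ℙⁿ_k` with
homogeneous coordinates `(w_l/wᵢ)_l ∈ 𝔬ⁿ⁺¹` (ring-valued points of `ℙⁿ`,
`Motives.ProjectiveSpace.vecChartPoint`), which restricts to `gen_B` on `Spec K` and therefore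
factors through the closed subscheme `B` (`IsClosedImmersion.liftOfRange`: `Spec 𝔬` is reduced
with dense generic point); (→) reads the chart functions `x_l/xᵢ` in the dominated local ring
`𝒪_{B,b}` (via `hasCentre_stalkSubring_iff_isDefinedAt`, `RationalMapsOfModels.lean`, and the
dictionary `isDefinedAt_iff_definedOn`). This extends the bridge of `RationalMapsOfModels.lean`
from local rings of points of models to arbitrary local rings of `K` (in particular to iterated
quadratic transforms), as needed to count base points in Zariski's patching argument
(Zariski–Samuel II, Ch. VI §17; Piltant 2013, proof of Lemma 5.6). Also: valuation-like rings
and `K` itself always have centres. All PROVED.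

## References

* O. Zariski, P. Samuel, *Commutative Algebra* II (1960), Ch. VI §17. [ZariskiSamuel1960]
* R. Hartshorne, *Algebraic Geometry* (1977), II Thm. 7.1. [Hartshorne1977]
* O. Piltant, RACSAM 107 (2013), §3 and proof of Lemma 5.6. [Piltant2013]
-/

noncomputable section

open CategoryTheory CategoryTheory.Limits AlgebraicGeometry TopologicalSpace IsLocalRing
open Literature.AlgebraicGeometry.Motives
open MvPolynomial

universe u

namespace Literature.AlgebraicGeometry.Resolution

attribute [local instance] MvPolynomial.gradedAlgebra

namespace ProjModel

variable {k K : Type u} [Field k] [Field K] [Algebra k K]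

/-! ## Homogeneous coordinates of the generic point of a model -/

/-- **Every projective model has homogeneous coordinates**: a closed `k`-immersion
`ι_B : B ↪ ℙⁿ_k` and `w ∈ Kⁿ⁺¹ ∖ 0` with `gen_B ≫ ι_B = (w₀ : … : wₙ)`. [folklore] -/
theorem exists_coords (B : ProjModel k K) :
    ∃ (n : ℕ) (ιB : B.X ⟶ Proj (Segre.grading (Fin (n + 1)) k)) (_ : IsClosedImmersion ιB)
      (_ : ιB ≫ Segre.toSpec (Fin (n + 1)) k = B.π) (w : Fin (n + 1) → K) (hw : w ≠ 0),
      B.gen ≫ ιB = (ProjectiveSpace.pointOfVec k w hw).left := by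
  obtain ⟨n, ιB', hιB'⟩ := B.isProjectiveOver
  let P₁ : AlgPoints (projectiveSpace n k) K := genOver B ≫ ιB'
  obtain ⟨w, hw, hPw⟩ := ProjectiveSpace.exists_eq_pointOfVec (k := k) (L := K) P₁
  exact ⟨n, ιB'.left, hιB', Over.w ιB', w, hw, by rw [← hPw]; rfl⟩

/-! ## Regular rational functions and `stalkSubring` -/

/-- `h ∈ K(A)` is regular at `a` iff its image in `K` lies in `𝒪_{A,a} ⊆ K`. [folklore] -/
theorem isRegularAt_iff_mem_stalkSubring (A : ProjModel k K) (a : A.X) (h : A.X.functionField) :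
    RatFn.IsRegularAt a h ↔ A.funFieldIso.hom.hom h ∈ A.stalkSubring a := by
  rw [mem_stalkSubring_iff]
  constructor
  · rintro ⟨t, rfl⟩
    exact ⟨t, rfl⟩
  · rintro ⟨t, ht⟩
    refine ⟨t, A.funFieldIso.commRingCatIsoToRingEquiv.injective ?_⟩
    exact ht

/-- **Dictionary**: the rational map `A ⋯→ ℙⁿ` given by `w` (read in `K(A) ≅ K`) is defined at
`a` iff `w` is defined on `𝒪_{A,a} ⊆ K`. [folklore] -/
theorem isDefinedAt_iff_definedOn (A : ProjModel k K) {n : ℕ} (w : Fin (n + 1) → K) (a : A.X) :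
    IsDefinedAt (fun l => A.funFieldAlgEquiv.symm (w l)) a ↔ DefinedOn w (A.stalkSubring a) := by
  have hval : ∀ z : K, A.funFieldIso.hom.hom (A.funFieldAlgEquiv.symm z) = z := fun z => by
    rw [funFieldAlgEquiv_symm_apply, ← CommRingCat.comp_apply, Iso.inv_hom_id, CommRingCat.id_apply]
  have hne : ∀ l, A.funFieldAlgEquiv.symm (w l) ≠ 0 ↔ w l ≠ 0 := fun l =>
    (map_ne_zero_iff _ A.funFieldAlgEquiv.symm.injective)
  constructor
  · rintro ⟨i, hi⟩
    rw [mem_lsChart_iff] at hi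
    refine ⟨i, (hne i).mp hi.1, fun l => ?_⟩
    have h := (isRegularAt_iff_mem_stalkSubring A a _).mp (hi.2 l)
    rwa [map_div₀, hval, hval] at h
  · rintro ⟨i, hi, hmem⟩
    refine ⟨i, (mem_lsChart_iff _).mpr ⟨(hne i).mpr hi, fun l => ?_⟩⟩
    rw [isRegularAt_iff_mem_stalkSubring, map_div₀, hval, hval]
    exact hmem l

/-! ## Centres and homogeneous coordinates -/

section Bridge

variable (B : ProjModel k K) {n : ℕ} (ιB : B.X ⟶ Proj (Segre.grading (Fin (n + 1)) k))
  [IsClosedImmersion ιB] (hιB : ιB ≫ Segre.toSpec (Fin (n + 1)) k = B.π)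
  (w : Fin (n + 1) → K) (hw : w ≠ 0)
  (hgenB : B.gen ≫ ιB = (ProjectiveSpace.pointOfVec k w hw).left)

include hιB hgenB in
/-- **(→) A local ring with a centre has the coordinates defined on it**: `w` is defined on the
dominated local ring `𝒪_{B,b}` (the chart functions `x_l/xᵢ` at `b`), hence on `𝔬`.
[cite: ZariskiSamuel1960, Ch. VI §17] -/
theorem HasCentre.definedOn {O : Subring K} (h : B.HasCentre O) : DefinedOn w O := by
  obtain ⟨b, hb⟩ := h
  have h1 : B.HasCentre (B.stalkSubring b) := ⟨b, isCentreOf_self B b⟩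
  have h2 := (hasCentre_stalkSubring_iff_isDefinedAt B B ιB hιB w hw hgenB b).mp h1
  rw [isDefinedAt_iff_definedOn] at h2
  exact h2.mono hb.1

include hgenB in
/-- **(←) A local ring of `K` containing `k` on which the coordinates are defined has a centre**:
`Spec 𝔬 → ℙⁿ_k` with homogeneous coordinates `(w_l/wᵢ)_l ∈ 𝔬ⁿ⁺¹` restricts to `gen_B` on
`Spec K`, so lands in the closed subscheme `B`. [cite: ZariskiSamuel1960, Ch. VI §17] -/
theorem hasCentre_of_definedOn {O : Subring K} [IsLocalRing O]
    (hkO : ∀ c : k, algebraMap k K c ∈ O) (hO : DefinedOn w O) : B.HasCentre O := by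
  classical
  obtain ⟨i, hi, hmem⟩ := hO
  letI : Algebra k O := ((algebraMap k K).codRestrict O hkO).toAlgebra
  let ρ : O →ₐ[k] K := { O.subtype with commutes' := fun _ => rfl }
  have hρ : (specOverOfAlgHom ρ).left = specKToSubring O := rfl
  -- homogeneous coordinates `v = (w_l / wᵢ)_l ∈ 𝔬ⁿ⁺¹`, `vᵢ = 1`
  let v : Fin (n + 1) → O := fun l => ⟨w l / w i, hmem l⟩
  have hvi : v i = 1 := Subtype.ext (div_self hi)
  have hv : IsUnit (aeval v (X i : MvPolynomial (Fin (n + 1)) k)) := by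
    rw [aeval_X, hvi]; exact isUnit_one
  have hρv : (fun l => ρ (v l)) = fun l => w l / w i := rfl
  have hwi : (fun l => w l / w i) ≠ 0 := fun h => by
    have := congr_fun h i
    rw [Pi.zero_apply, div_self hi] at this
    exact one_ne_zero this
  have hwi' : aeval (fun l => w l / w i) (X i : MvPolynomial (Fin (n + 1)) k) ≠ 0 := by
    rw [aeval_X, div_self hi]; exact one_ne_zero
  -- `g : Spec 𝔬 → ℙⁿ_k`
  let g : Spec (CommRingCat.of O) ⟶ Proj (Segre.grading (Fin (n + 1)) k) :=
    (ProjectiveSpace.vecChartPoint (ProjectiveSpace.X_mem i) one_pos v hv).left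
  -- on `Spec K` it is `(w₀ : … : wₙ) = gen_B ≫ ι_B`
  have hg : specKToSubring O ≫ g = B.gen ≫ ιB := by
    have h1 := ProjectiveSpace.specOverOfAlgHom_comp_vecChartPoint ρ (ProjectiveSpace.X_mem i) one_pos v hv
      (ProjectiveSpace.isUnit_aeval_comp ρ hv)
    have h2 : specKToSubring O ≫ g = (ProjectiveSpace.vecChartPoint (ProjectiveSpace.X_mem i)
        one_pos (fun j => ρ (v j)) (ProjectiveSpace.isUnit_aeval_comp ρ hv)).left := by
      rw [← h1, ← hρ]; rfl
    rw [hgenB, ← ProjectiveSpace.pointOfVec_smul w hw (w i)⁻¹ (inv_ne_zero hi)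
      (by rw [show (w i)⁻¹ • w = fun l => w l / w i from funext fun l => by
        rw [Pi.smul_apply, smul_eq_mul, div_eq_inv_mul]]; exact hwi)]
    change specKToSubring O ≫ g = (ProjectiveSpace.pointOfVec k ((w i)⁻¹ • w) _).left
    have h3 : (w i)⁻¹ • w = fun l => w l / w i :=
      funext fun l => by rw [Pi.smul_apply, smul_eq_mul, div_eq_inv_mul]
    simp only [h3]
    rw [ProjectiveSpace.pointOfVec_eq_chartPoint _ hwi (ProjectiveSpace.X_mem i) one_pos hwi',
      ← ProjectiveSpace.vecChartPoint_eq_chartPoint]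
    exact h2
  -- the range of `g` lies in `B`
  have hrange : Set.range g ⊆ Set.range ιB := by
    rintro _ ⟨p, rfl⟩
    have h1 : g p ∈ closure (g '' {specKToSubring O (closedPoint K)}) :=
      map_mem_closure g.continuous (mem_closure_specKToSubring p) fun x hx => Set.mem_image_of_mem g hx
    rw [Set.image_singleton, ← Scheme.Hom.comp_apply, hg] at h1
    have hmem : (B.gen ≫ ιB) (closedPoint K) ∈ Set.range ιB := ⟨_, rfl⟩
    exact closure_minimal (Set.singleton_subset_iff.mpr hmem) ιB.isClosedEmbedding.isClosed_range h1
  let l : Spec (CommRingCat.of O) ⟶ B.X := IsClosedImmersion.liftOfRange ιB g hrange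
  refine (hasCentre_iff_exists_lift (M := B)).mpr ⟨l, ?_⟩
  rw [← cancel_mono ιB, Category.assoc, IsClosedImmersion.liftOfRange_fac, hg]

include hιB hgenB in
/-- **Centres and homogeneous coordinates**: a local ring `𝔬 ⊆ K` containing `k` has a centre on
`B` iff the homogeneous coordinates of `gen_B` are defined on `𝔬`.
[cite: ZariskiSamuel1960, Ch. VI §17] -/
theorem hasCentre_iff_definedOn {O : Subring K} [IsLocalRing O]
    (hkO : ∀ c : k, algebraMap k K c ∈ O) : B.HasCentre O ↔ DefinedOn w O :=
  ⟨fun h => h.definedOn B ιB hιB w hw hgenB, hasCentre_of_definedOn B ιB w hw hgenB hkO⟩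

end Bridge

/-! ## Rings which always have centres -/

/-- **A valuation ring of `K/k` has a centre on every projective model** (in subring form).
[cite: ZariskiSamuel1960, Ch. VI §17] -/
theorem hasCentre_of_mem_or_inv_mem (B : ProjModel k K) {O : Subring K}
    (hO : ∀ z : K, z ∈ O ∨ z⁻¹ ∈ O) (hkO : ∀ c : k, algebraMap k K c ∈ O) : B.HasCentre O :=
  B.hasCentre_valuationSubring ⟨⟨O, hO⟩, hkO⟩

/-- `K` itself has a centre (the generic point). [folklore] -/
theorem hasCentre_top (B : ProjModel k K) : B.HasCentre (⊤ : Subring K) :=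
  ⟨_, B.isCentreOf_top_genericPoint⟩

end ProjModel

end Literature.AlgebraicGeometry.Resolution

end
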